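import Summits.CriticalPhenomena.Ising3DConformalLimit.Theses.PerfectScreening
import Literature.Probability.LatticeModels.SRWReturnFourier

/-!
# Watson's integral, part B: a sharp Gaussian bound on the even moments of the free symbol
(crux stmt-CriticalPhenomena-1341, line `certified-core-eventual-tail`, stub `stub_order_beyond_threshold`)

For `φ(θ) = ⅓ Σⱼ cos θⱼ` on the Brillouin zone `[-π,π]³` and `n ≥ 1`:
`∫ φ^{2n} ≤ 2 (144π/(43 n))^{3/2} + (2π)³ (245/288)^{2n}` (`integral_symbol_pow_le`), i.e. the
return probabilities of the simple random walk on `ℤ³` obey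
`P(S_{2n} = 0) ≤ 0.2752 n^{-3/2} + 0.851^{2n}` — within 18 % of the local limit constant
`2 (3/(4π))^{3/2} = 0.2333`, versus the factor `17` of the tree's general-`d` bound
`SRW.prob_le_inv_sqrt_pow` (Jordan's constant `2/π²` and a factor `2^d` on the antipodal Gaussian).
Ingredients: `cos x ≤ 1 - (43/96) x²` on `|x| ≤ 1` (Mathlib `Real.cos_bound`), whence
`0 ≤ φ ≤ exp(-(43/288)|θ|²)` on `max |θⱼ| ≤ 1`, the same at the antipode `min |θⱼ| ≥ π - 1`, and
`|φ| ≤ 245/288` elsewhere (`cos 1 ≤ 53/96`, as in `Literature.Geometry.Riemannian.SphericalCylinderConformal.cos_one_le`); the antipodal Gaussian is integrated over the zone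
only (`∫_{-π}^{π} e^{-a(π-|t|)²} dt ≤ (π/a)^{1/2}`). Used with part A in part C to certify
`latticeGreen (0 : Site 3) ≤ 13/25`.
-/

noncomputable section

namespace Summit.CriticalPhenomena.Ising3DConformalLimit.Theorems.PerfectScreening.CcetGreen

open MeasureTheory Finset Real intervalIntegral
open Literature.Probability.LatticeModels

/-! ### Elementary cosine bounds -/

/-- `cos x ≤ 1 - (43/96) x²` for `|x| ≤ 1` (from Mathlib's `Real.cos_bound`). -/
theorem cos_le_one_sub_mul_sq {x : ℝ} (hx : |x| ≤ 1) : Real.cos x ≤ 1 - 43 / 96 * x ^ 2 := by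
  have h := Real.cos_bound hx
  have h1 : Real.cos x ≤ 1 - x ^ 2 / 2 + |x| ^ 4 * (5 / 96) := by linarith [(abs_le.1 h).2]
  have hx2 : |x| ^ 2 ≤ 1 := by
    have : |x| ^ 2 ≤ 1 ^ 2 := pow_le_pow_left₀ (abs_nonneg x) hx 2
    simpa using this
  have h2 : |x| ^ 4 ≤ x ^ 2 := by
    calc |x| ^ 4 = |x| ^ 2 * |x| ^ 2 := by ring
      _ ≤ |x| ^ 2 * 1 := by gcongr
      _ = x ^ 2 := by rw [sq_abs]; ring
  nlinarith

/-! ### The pointwise bound on the symbol -/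

/-- A sum of three cosines with one of them `≤ 53/96` is `≤ 2 + 53/96`. -/
theorem sum_cos_le_of_one_le {θ : Fin 3 → ℝ} (j : Fin 3) (hj : Real.cos (θ j) ≤ 53 / 96) :
    ∑ l, Real.cos (θ l) ≤ 245 / 96 := by
  have h : ∑ l ∈ Finset.univ.erase j, Real.cos (θ l) ≤ ∑ l ∈ Finset.univ.erase j, (1 : ℝ) :=
    Finset.sum_le_sum fun l _ => Real.cos_le_one _
  have hc : (Finset.univ.erase j).card = 2 := by
    rw [Finset.card_erase_of_mem (Finset.mem_univ j), Finset.card_univ, Fintype.card_fin]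
  rw [Finset.sum_const, hc] at h
  have h' := Finset.add_sum_erase Finset.univ (fun l => Real.cos (θ l)) (Finset.mem_univ j)
  simp only [nsmul_eq_mul, Nat.cast_ofNat, mul_one] at h
  linarith

/-- A sum of three cosines with one of them `≥ -53/96` is `≥ -(2 + 53/96)`. -/
theorem le_sum_cos_of_le_one {θ : Fin 3 → ℝ} (j : Fin 3) (hj : -(53 / 96) ≤ Real.cos (θ j)) :
    -(245 / 96) ≤ ∑ l, Real.cos (θ l) := by
  have h : ∑ l ∈ Finset.univ.erase j, (-1 : ℝ) ≤ ∑ l ∈ Finset.univ.erase j, Real.cos (θ l) :=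
    Finset.sum_le_sum fun l _ => Real.neg_one_le_cos _
  have hc : (Finset.univ.erase j).card = 2 := by
    rw [Finset.card_erase_of_mem (Finset.mem_univ j), Finset.card_univ, Fintype.card_fin]
  rw [Finset.sum_const, hc] at h
  have h' := Finset.add_sum_erase Finset.univ (fun l => Real.cos (θ l)) (Finset.mem_univ j)
  simp only [smul_neg, nsmul_eq_mul, Nat.cast_ofNat, mul_one] at h
  linarith

/-- **Pointwise bound on the free symbol** `φ = ⅓ Σⱼ cos θⱼ` on `[-π,π]³`:
`φ^{2n} ≤ exp(-(43n/144) Σ θⱼ²) + exp(-(43n/144) Σ (π-|θⱼ|)²) + (245/288)^{2n}`. -/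
theorem symbol_pow_le {θ : Fin 3 → ℝ} (hθ : θ ∈ brillouin 3) (n : ℕ) :
    ((3 : ℝ)⁻¹ * ∑ j, Real.cos (θ j)) ^ (2 * n) ≤
      Real.exp (-(43 / 144 * n) * ∑ j, θ j ^ 2) +
        Real.exp (-(43 / 144 * n) * ∑ j, (π - |θ j|) ^ 2) + (245 / 288 : ℝ) ^ (2 * n) := by
  have hθj : ∀ j, |θ j| ≤ π := fun j => abs_le.2 (hθ j (Set.mem_univ _))
  set φ : ℝ := (3 : ℝ)⁻¹ * ∑ j, Real.cos (θ j) with hφ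
  have hpos1 := Real.exp_pos (-(43 / 144 * n) * ∑ j, θ j ^ 2)
  have hpos2 := Real.exp_pos (-(43 / 144 * n) * ∑ j, (π - |θ j|) ^ 2)
  have hpos3 : (0 : ℝ) ≤ (245 / 288 : ℝ) ^ (2 * n) := by positivity
  have heven : Even (2 * n) := even_two_mul n
  by_cases hA : ∀ j, |θ j| ≤ 1
  · -- near the origin: `0 ≤ φ ≤ exp(-(43/288) Σ θⱼ²)`
    have hc : ∀ j, Real.cos (θ j) ≤ 1 - 43 / 96 * θ j ^ 2 := fun j => cos_le_one_sub_mul_sq (hA j)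
    have hc0 : ∀ j, 0 ≤ Real.cos (θ j) := fun j =>
      Real.cos_nonneg_of_neg_pi_div_two_le_of_le (by linarith [(abs_le.1 (hA j)).1, pi_gt_three])
        (by linarith [(abs_le.1 (hA j)).2, pi_gt_three])
    have hφ0 : 0 ≤ φ := mul_nonneg (by norm_num) (Finset.sum_nonneg fun j _ => hc0 j)
    have hφ1 : φ ≤ 1 - 43 / 288 * ∑ j, θ j ^ 2 := by
      simp only [hφ, Fin.sum_univ_three]
      linarith [hc 0, hc 1, hc 2]
    have hexp : φ ≤ Real.exp (-(43 / 288 * ∑ j, θ j ^ 2)) :=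
      hφ1.trans (Real.one_sub_le_exp_neg _)
    have hpow : φ ^ (2 * n) ≤ Real.exp (-(43 / 288 * ∑ j, θ j ^ 2)) ^ (2 * n) :=
      pow_le_pow_left₀ hφ0 hexp _
    rw [← Real.exp_nat_mul] at hpow
    have e : ((2 * n : ℕ) : ℝ) * -(43 / 288 * ∑ j, θ j ^ 2) = -(43 / 144 * n) * ∑ j, θ j ^ 2 := by
      push_cast; ring
    rw [e] at hpow
    linarith
  · by_cases hB : ∀ j, π - 1 ≤ |θ j|
    · -- near the antipode: `0 ≤ -φ ≤ exp(-(43/288) Σ (π-|θⱼ|)²)`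
      have hneg : ∀ j, -Real.cos (θ j) = Real.cos (π - |θ j|) := fun j => by
        rw [Real.cos_pi_sub, Real.cos_abs]
      have habs : ∀ j, abs (π - |θ j|) ≤ 1 := fun j =>
        abs_le.2 ⟨by linarith [hθj j], by linarith [hB j]⟩
      have hc : ∀ j, -Real.cos (θ j) ≤ 1 - 43 / 96 * (π - |θ j|) ^ 2 := fun j => by
        rw [hneg j]; exact cos_le_one_sub_mul_sq (habs j)
      have hc0 : ∀ j, 0 ≤ -Real.cos (θ j) := fun j => by
        rw [hneg j]
        exact Real.cos_nonneg_of_neg_pi_div_two_le_of_le (by linarith [hθj j, pi_gt_three])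
          (by linarith [hB j, pi_gt_three])
      have hφ0 : 0 ≤ -φ := by
        have : -φ = (3 : ℝ)⁻¹ * ∑ j, -Real.cos (θ j) := by
          rw [hφ, Finset.sum_neg_distrib]; ring
        rw [this]
        exact mul_nonneg (by norm_num) (Finset.sum_nonneg fun j _ => hc0 j)
      have hφ1 : -φ ≤ 1 - 43 / 288 * ∑ j, (π - |θ j|) ^ 2 := by
        simp only [hφ, Fin.sum_univ_three]
        have h0 := hc 0; have h1 := hc 1; have h2 := hc 2
        linarith
      have hexp : -φ ≤ Real.exp (-(43 / 288 * ∑ j, (π - |θ j|) ^ 2)) :=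
        hφ1.trans (Real.one_sub_le_exp_neg _)
      have hpow : (-φ) ^ (2 * n) ≤ Real.exp (-(43 / 288 * ∑ j, (π - |θ j|) ^ 2)) ^ (2 * n) :=
        pow_le_pow_left₀ hφ0 hexp _
      rw [heven.neg_pow, ← Real.exp_nat_mul] at hpow
      have e : ((2 * n : ℕ) : ℝ) * -(43 / 288 * ∑ j, (π - |θ j|) ^ 2) =
          -(43 / 144 * n) * ∑ j, (π - |θ j|) ^ 2 := by
        push_cast; ring
      rw [e] at hpow
      linarith
    · -- elsewhere: `|φ| ≤ 245/288`
      push Not at hA hB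
      obtain ⟨j, hj⟩ := hA
      obtain ⟨k, hk⟩ := hB
      have cos_one_le : Real.cos 1 ≤ 53 / 96 := by
        have := cos_le_one_sub_mul_sq (x := 1) (by norm_num)
        linarith
      have hup : Real.cos (θ j) ≤ 53 / 96 := by
        rw [← Real.cos_abs]
        exact (Real.cos_le_cos_of_nonneg_of_le_pi (by norm_num) (hθj j) hj.le).trans cos_one_le
      have hlo : -(53 / 96) ≤ Real.cos (θ k) := by
        rw [← Real.cos_abs]
        have h := Real.cos_le_cos_of_nonneg_of_le_pi (abs_nonneg _) (by linarith) hk.le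
        rw [Real.cos_pi_sub] at h
        linarith [cos_one_le]
      have h1 : φ ≤ 245 / 288 := by
        have := sum_cos_le_of_one_le j hup
        rw [hφ]; linarith
      have h2 : -(245 / 288) ≤ φ := by
        have := le_sum_cos_of_le_one k hlo
        rw [hφ]; linarith
      have habs : |φ| ≤ 245 / 288 := abs_le.2 ⟨h2, h1⟩
      have hpow : |φ| ^ (2 * n) ≤ (245 / 288 : ℝ) ^ (2 * n) := pow_le_pow_left₀ (abs_nonneg _) habs _
      rw [heven.pow_abs] at hpow
      linarith

/-! ### The antipodal Gaussian over the zone (sharp) -/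

/-- `∫_{[-π,π]} e^{-a(π-|t|)²} dt ≤ (π/a)^{1/2}` for `a > 0` (two half-Gaussians). -/
theorem integral_Icc_exp_neg_mul_pi_sub_abs_sq_le {a : ℝ} (ha : 0 < a) :
    ∫ t in Set.Icc (-π) π, Real.exp (-a * (π - |t|) ^ 2) ≤ Real.sqrt (π / a) := by
  have hcont : Continuous fun t : ℝ => Real.exp (-a * (π - |t|) ^ 2) := by fun_prop
  rw [integral_Icc_eq_integral_Ioc, ← intervalIntegral.integral_of_le (by linarith [pi_pos]),
    ← intervalIntegral.integral_add_adjacent_intervals (b := 0) (hcont.intervalIntegrable _ _)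
      (hcont.intervalIntegrable _ _)]
  have h1 : ∫ t in (-π)..0, Real.exp (-a * (π - |t|) ^ 2) = ∫ t in (0 : ℝ)..π, Real.exp (-a * t ^ 2) := by
    have heq : ∫ t in (-π)..0, Real.exp (-a * (π - |t|) ^ 2) =
        ∫ t in (-π)..0, Real.exp (-a * (π + t) ^ 2) := by
      refine intervalIntegral.integral_congr fun t ht => ?_
      rw [Set.uIcc_of_le (by linarith [pi_pos])] at ht
      simp only [abs_of_nonpos ht.2, sub_neg_eq_add]
    rw [heq, intervalIntegral.integral_comp_add_left (fun s => Real.exp (-a * s ^ 2)) π]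
    simp
  have h2 : ∫ t in (0 : ℝ)..π, Real.exp (-a * (π - |t|) ^ 2) = ∫ t in (0 : ℝ)..π, Real.exp (-a * t ^ 2) := by
    have heq : ∫ t in (0 : ℝ)..π, Real.exp (-a * (π - |t|) ^ 2) =
        ∫ t in (0 : ℝ)..π, Real.exp (-a * (π - t) ^ 2) := by
      refine intervalIntegral.integral_congr fun t ht => ?_
      rw [Set.uIcc_of_le pi_pos.le] at ht
      simp only [abs_of_nonneg ht.1]
    rw [heq, intervalIntegral.integral_comp_sub_left (fun s => Real.exp (-a * s ^ 2)) π]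
    simp
  have h3 : ∫ t in (0 : ℝ)..π, Real.exp (-a * t ^ 2) ≤ Real.sqrt (π / a) / 2 := by
    rw [intervalIntegral.integral_of_le pi_pos.le, ← integral_gaussian_Ioi a]
    exact setIntegral_mono_set (integrable_exp_neg_mul_sq ha).integrableOn
      (ae_of_all _ fun t => (Real.exp_pos _).le) Set.Ioc_subset_Ioi_self.eventuallyLE
  rw [h1, h2]
  linarith

/-- `∫_{[-π,π]³} e^{-a Σ (π-|θⱼ|)²} dθ ≤ (π/a)^{3/2}` for `a > 0` (product of the previous). -/
theorem integral_brillouin_exp_antipodal_le {a : ℝ} (ha : 0 < a) :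
    ∫ θ in brillouin 3, Real.exp (-a * ∑ j, (π - |θ j|) ^ 2) ≤ Real.sqrt (π / a) ^ 3 := by
  have hprod : ∀ θ : Fin 3 → ℝ, Real.exp (-a * ∑ j, (π - |θ j|) ^ 2) =
      ∏ j, Real.exp (-a * (π - |θ j|) ^ 2) := by
    intro θ; rw [Finset.mul_sum, Real.exp_sum]
  simp_rw [hprod]
  rw [SRW.volume_restrict_brillouin,
    integral_fintype_prod_eq_pow (f := fun t : ℝ => Real.exp (-a * (π - |t|) ^ 2))]
  simp only [Fintype.card_fin]
  exact pow_le_pow_left₀ (integral_nonneg fun t => (Real.exp_pos _).le)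
    (integral_Icc_exp_neg_mul_pi_sub_abs_sq_le ha) 3

/-! ### The moment bound -/

/-- The volume of the zone: `∫_{[-π,π]³} 1 = (2π)³`. -/
theorem integral_brillouin_one : ∫ _θ in brillouin 3, (1 : ℝ) = (2 * π) ^ 3 := by
  have h := @Literature.Probability.LatticeModels.SRW.count_zero_eq_integral 3 0
  simp only [pow_zero, SRW.count_zero, if_true, Nat.cast_one] at h
  have hπ : (2 * π) ^ 3 ≠ 0 := by positivity
  field_simp at h
  linarith

/-- **Sharp Gaussian bound on the even moments of the free symbol** (`n ≥ 1`):
`∫_{[-π,π]³} (⅓ Σⱼ cos θⱼ)^{2n} dθ ≤ 2 (144π/(43n))^{3/2} + (2π)³ (245/288)^{2n}`. -/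
theorem ccetGreen_moment_le : ∀ n : ℕ, 1 ≤ n → ∫ θ in brillouin 3, ((3 : ℝ)⁻¹ * ∑ j, Real.cos (θ j)) ^ (2 * n) ≤ 2 * Real.sqrt (π / (43 / 144 * n)) ^ 3 + (2 * π) ^ 3 * (245 / 288 : ℝ) ^ (2 * n) := by
  intro n hn
  have hn' : (0 : ℝ) < n := by exact_mod_cast hn
  set a : ℝ := 43 / 144 * n with ha
  have hapos : 0 < a := by positivity
  have hK := isCompact_brillouin 3
  have hi0 : IntegrableOn (fun θ : Fin 3 → ℝ => ((3 : ℝ)⁻¹ * ∑ j, Real.cos (θ j)) ^ (2 * n))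
      (brillouin 3) volume :=
    (by fun_prop : Continuous fun θ : Fin 3 → ℝ => ((3 : ℝ)⁻¹ * ∑ j, Real.cos (θ j)) ^ (2 * n))
      |>.continuousOn.integrableOn_compact hK
  have hi1 : IntegrableOn (fun θ : Fin 3 → ℝ => Real.exp (-a * ∑ j, θ j ^ 2)) (brillouin 3) volume :=
    (by fun_prop : Continuous fun θ : Fin 3 → ℝ => Real.exp (-a * ∑ j, θ j ^ 2))
      |>.continuousOn.integrableOn_compact hK
  have hi2 : IntegrableOn (fun θ : Fin 3 → ℝ => Real.exp (-a * ∑ j, (π - |θ j|) ^ 2))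
      (brillouin 3) volume :=
    (by fun_prop : Continuous fun θ : Fin 3 → ℝ => Real.exp (-a * ∑ j, (π - |θ j|) ^ 2))
      |>.continuousOn.integrableOn_compact hK
  have hi3 : IntegrableOn (fun _θ : Fin 3 → ℝ => (245 / 288 : ℝ) ^ (2 * n)) (brillouin 3) volume :=
    continuous_const.continuousOn.integrableOn_compact hK
  calc ∫ θ in brillouin 3, ((3 : ℝ)⁻¹ * ∑ j, Real.cos (θ j)) ^ (2 * n)
      ≤ ∫ θ in brillouin 3, (Real.exp (-a * ∑ j, θ j ^ 2) +
          Real.exp (-a * ∑ j, (π - |θ j|) ^ 2) + (245 / 288 : ℝ) ^ (2 * n)) :=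
        setIntegral_mono_on hi0 ((hi1.add hi2).add hi3) (measurableSet_brillouin 3)
          fun θ hθ => symbol_pow_le hθ n
    _ = (∫ θ in brillouin 3, Real.exp (-a * ∑ j, θ j ^ 2)) +
          (∫ θ in brillouin 3, Real.exp (-a * ∑ j, (π - |θ j|) ^ 2)) +
          ∫ _θ in brillouin 3, (245 / 288 : ℝ) ^ (2 * n) := by
        have e1 : ∫ θ in brillouin 3, (Real.exp (-a * ∑ j, θ j ^ 2) +
            Real.exp (-a * ∑ j, (π - |θ j|) ^ 2) + (245 / 288 : ℝ) ^ (2 * n)) =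
            (∫ θ in brillouin 3, (Real.exp (-a * ∑ j, θ j ^ 2) +
              Real.exp (-a * ∑ j, (π - |θ j|) ^ 2))) +
              ∫ _θ in brillouin 3, (245 / 288 : ℝ) ^ (2 * n) :=
          integral_add (hi1.add hi2) hi3
        have e2 : ∫ θ in brillouin 3, (Real.exp (-a * ∑ j, θ j ^ 2) +
            Real.exp (-a * ∑ j, (π - |θ j|) ^ 2)) =
            (∫ θ in brillouin 3, Real.exp (-a * ∑ j, θ j ^ 2)) +
              ∫ θ in brillouin 3, Real.exp (-a * ∑ j, (π - |θ j|) ^ 2) :=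
          integral_add hi1 hi2
        rw [e1, e2]
    _ ≤ Real.sqrt (π / a) ^ 3 + Real.sqrt (π / a) ^ 3 + (2 * π) ^ 3 * (245 / 288 : ℝ) ^ (2 * n) := by
        refine add_le_add (add_le_add (SRW.integral_brillouin_exp_neg_mul_sum_sq_le hapos)
          (integral_brillouin_exp_antipodal_le hapos)) (le_of_eq ?_)
        have h := integral_brillouin_one
        rw [show (fun _θ : Fin 3 → ℝ => (245 / 288 : ℝ) ^ (2 * n)) =
          fun _θ => (245 / 288 : ℝ) ^ (2 * n) * (1 : ℝ) from by simp,
          MeasureTheory.integral_const_mul, h]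
        ring
    _ = 2 * Real.sqrt (π / (43 / 144 * n)) ^ 3 + (2 * π) ^ 3 * (245 / 288 : ℝ) ^ (2 * n) := by
        rw [ha]; ring

end Summit.CriticalPhenomena.Ising3DConformalLimit.Theorems.PerfectScreening.CcetGreen

end
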